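/-
Copyright (c) 2026 the pub-hodgecm-mathlib formalisation cell (harness21).  Prover seat hodgecm-mathlib-LA7-p01 (g3), «GO 500» half A,
organ (S1b) of A-p01 (g28)'s `stub_ESHEET` organ map (LA5-plan (g3) DEAL L5-#3), clause (m5); 2026-09-02.
-/
import Literature.AlgebraicGeometry.AbelianSchemes.SerreTensorIdealTranslationQuasiInverse
import Literature.AlgebraicGeometry.AbelianSchemes.AbelianSchemeOverQuasiInverseIsogeny
import Literature.AlgebraicGeometry.AbelianSchemes.DualPairHatIsOfRelDim
import Literature.AlgebraicGeometry.Motives.AbelianVarietyIsogenyProofs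
import HarnessLib

/-!
# The Serre twist `A ⊗_𝒪 𝔟` has the relative dimension of `A` ([Conrad2004GrossZagier] §7 Thm. 7.5; [GortzWedhorn2020] Rem. 16.54)

Topic `AlgebraicGeometry/AbelianSchemes`, namespace `Literature.AlgebraicGeometry.AbelianSchemes.AbelianSchemeOver`.  THEOREMS ONLY (no definition, no named
fact, no `instance`, no notation, no `sorry`; ANY base scheme `S`).  Cell `hodgecm-mathlib` (D-0151), F0∕P6 «MOD», «GO 500» half A, X-LEAF socket `stub_ESHEET`
(E-pen A-p01 (g28) memo 66df4d8c), **organ (S1b) «MODULI MEMBERSHIP OF THE SERRE TWIST», clause (m5) `IsOfRelDim`** (LA5-plan (g3) DEAL L5-#3 → LA7-p01 (g3));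
`--supports stmt-HodgeConjecture-24832`, count-neutral.  HONEST LABEL: HC_CM is proved only modulo the 7 printed citations (2 remaining: hLiu418 =
stmt-HodgeConjecture-24832, h413 = stmt-HodgeConjecture-24833) until rung 0 closes; this file discharges none of them.

## Mathematics

With a quasi-inverse presentation `(E′, P, Q, N)` (`E′P = P`, `QE′ = Q`, `QP = N`, `PQ = N·E′`, `N ≠ 0`) the ideal translation `ψ_P : A → A ⊗_𝒪 𝔟` and
`ψ′ : A ⊗_𝒪 𝔟 → A` satisfy `ψ_P ψ′ = [N]`, `ψ′ ψ_P = [N]` (★ `serreTranslate_comp_serreTranslateInv`, ★ `serreTranslateInv_comp_serreTranslate`), so at every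
field-valued point `s` the fibre `(ψ_P)_s : A_s → (A ⊗ 𝔟)_s` is an isogeny (★ `isIsogeny_fibreHom_of_quasiInverse`) and `dim (A ⊗ 𝔟)_s = dim A_s` (★
`AbelianVariety.dim_eq_of_isIsogeny`, [MumfordAV1970] §7 App. 3).  Relative dimension of an abelian scheme is read on the fibres (★
`isOfRelDim_iff_forall_dim_fibre`, [GortzWedhorn2020] Rem. 16.54), hence **`A ⊗_𝒪 𝔟` has relative dimension `g` iff `A` does** — the `relDim` field of
the Serre-twisted moduli tuple `(A ⊗ 𝔞⁻¹, λ_𝔞, η_𝔞) ∈ 𝒜_{g,δ,n}(S)` ([RapoportSmithlingZhang2020Diagonal] (4.23)).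

* `dim_fibre_serreTensor_eq` — `dim (A ⊗ 𝔟)_s = dim A_s`;
* **`isOfRelDim_serreTensor`** — `A.IsOfRelDim g → (A ⊗ 𝔟).IsOfRelDim g`; `isOfRelDim_serreTensor_iff`.

## References
* [Conrad2004GrossZagier] B. Conrad, *Gross–Zagier revisited*, MSRI Publ. 49 (2004), §7 Thm. 7.5.
* [MumfordAV1970] D. Mumford, *Abelian Varieties* (1970), §7 Application 3 (p. 63), §19 Remark (p. 169).
* [GortzWedhorn2020] U. Görtz, T. Wedhorn, *Algebraic Geometry I*, 2nd ed. (2020), Remark 16.54 (p. 539).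
* [RapoportSmithlingZhang2020Diagonal] M. Rapoport, B. Smithling, W. Zhang (2020), §4.3 (4.23) (p. 21).
-/

set_option autoImplicit false

-- as the ★ Serre-tensor files: `Over`/`Scheme` wrappers are semireducible
set_option backward.isDefEq.respectTransparency false

noncomputable section

universe u

open CategoryTheory CategoryTheory.Limits AlgebraicGeometry MonoidalCategory CartesianMonoidalCategory
open scoped MonObj

namespace Literature.AlgebraicGeometry.AbelianSchemes

namespace AbelianSchemeOver

open Literature.AlgebraicGeometry.Motives

variable {S : Scheme.{u}} {A : AbelianSchemeOver S} {O : Type*} [CommRing O] (act : A.RingAction O) [IsCommMonObj A.X]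
  {m : ℕ} (E' : Matrix (Fin m) (Fin m) O) (hE' : E' * E' = E') (P : Matrix (Fin m) (Fin 1) O) (Q : Matrix (Fin 1) (Fin m) O) {N : ℕ}

/-- **`dim (A ⊗ 𝔟)_s = dim A_s`** at every field-valued point: `(ψ_P)_s` is an isogeny (quasi-inverse `ψ′`, `N ≠ 0`).
[cite: MumfordAV1970, §7 Application 3 (p. 63)] [cite: Conrad2004GrossZagier, §7 (Thm. 7.5)] -/
theorem dim_fibre_serreTensor_eq (hN : N ≠ 0) (hP : E' * P = P) (hQ : Q * E' = Q)
    (hQP : Q * P = Matrix.scalar (Fin 1) (N : O)) (hPQ : P * Q = Matrix.scalar (Fin m) (N : O) * E')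
    {K : Type u} [Field K] (s : Spec (.of K) ⟶ S) :
    ((serreTensor act E' hE').fibre s).toAbelianVariety.dim = (A.fibre s).toAbelianVariety.dim := by
  haveI := isMonHom_serreTranslate act E' hE' P
  exact (AbelianVariety.dim_eq_of_isIsogeny
    (isIsogeny_fibreHom_of_quasiInverse (serreTranslate act E' hE' P) (serreTranslateInv act E' hE' Q) hN
      (serreTranslate_comp_serreTranslateInv act E' hE' P Q hP hQ hQP)
      (serreTranslateInv_comp_serreTranslate act E' hE' P Q hP hQ hPQ) s)).symm

/-- **THE SERRE TWIST HAS RELATIVE DIMENSION `g`** when `A` does — the `relDim` field of the twisted moduli tuple `(A ⊗ 𝔞⁻¹, λ_𝔞, η_𝔞)`.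
[cite: RapoportSmithlingZhang2020Diagonal, §4.3 (4.23) (p. 21)] [cite: GortzWedhorn2020, Remark 16.54 (p. 539)] -/
theorem isOfRelDim_serreTensor (hN : N ≠ 0) (hP : E' * P = P) (hQ : Q * E' = Q)
    (hQP : Q * P = Matrix.scalar (Fin 1) (N : O)) (hPQ : P * Q = Matrix.scalar (Fin m) (N : O) * E')
    {g : ℕ} (hA : A.IsOfRelDim g) : (serreTensor act E' hE').IsOfRelDim g :=
  isOfRelDim_of_forall_dim_fibre _ fun _ _ s =>
    (dim_fibre_serreTensor_eq act E' hE' P Q hN hP hQ hQP hPQ s).trans (dim_fibre_of_isOfRelDim hA s)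

/-- `A ⊗ 𝔟` has relative dimension `g` iff `A` does. [cite: GortzWedhorn2020, Remark 16.54 (p. 539)] [cite: MumfordAV1970, §7 Application 3 (p. 63)] -/
theorem isOfRelDim_serreTensor_iff (hN : N ≠ 0) (hP : E' * P = P) (hQ : Q * E' = Q)
    (hQP : Q * P = Matrix.scalar (Fin 1) (N : O)) (hPQ : P * Q = Matrix.scalar (Fin m) (N : O) * E') (g : ℕ) :
    (serreTensor act E' hE').IsOfRelDim g ↔ A.IsOfRelDim g :=
  ⟨fun h => isOfRelDim_of_forall_dim_fibre _ fun _ _ s =>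
      (dim_fibre_serreTensor_eq act E' hE' P Q hN hP hQ hQP hPQ s).symm.trans (dim_fibre_of_isOfRelDim h s),
    isOfRelDim_serreTensor act E' hE' P Q hN hP hQ hQP hPQ⟩

end AbelianSchemeOver

end Literature.AlgebraicGeometry.AbelianSchemes

end
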